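import Literature.Topology.FourManifolds.LefschetzModelFacts
import Literature.Geometry.Symplectic.LefschetzSteinRealisation
import Literature.GroupTheory.CombinatorialGroupTheory.SignedHurwitzReach
import Literature.Topology.FourManifolds.HomotopyS4CompactProofs
import Literature.Topology.FourManifolds.HomotopyS4OrientableProofs
import Literature.Topology.FourManifolds.HandlebodySplitting
import Literature.Geometry.Symplectic.SteinDomain
import Literature.AlgebraicTopology.SingularHomology.SingularChains
import HarnessLib

/-!
# The sorted-model dictionary of a nice splitting, from the six Lefschetz-model named facts
(stub `stub_sortedModelOfHandleSplitting` of line `modp-braid-orbits`, reshape r9, crux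
`ConvexBisection.AcyclicBisectionExists`, item stmt-SmoothPoincare4-10508, route
route-SmoothPoincare4-ConvexBisection)

The one geometric stub of the r8 skeleton of the line — for a homotopy 4-sphere `M` (presented as a nice
splitting `A ∪_{φ₀} B`, data which the proof does not need): an integral signed word `l` at some genus `g`
with `4g` letters, `2g` of them positive, non-zero classes spanning `ℚ^{2g}`, trivial signed monodromy, and
the REALISATION of every reachable sorted bi-spanning word `l'` as a Stein gluing `M = W₁ ∪_φ W₂` with one
open book supporting both boundary plane fields, `W₁` connected, ℚ-acyclic, `H₁(W₁; ℤ) ≅ ℤ^{2g'}/⟨positive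
classes⟩ — is here PROVED from the six named facts of the Lefschetz-handlebody dictionary
(`Literature/Topology/FourManifolds/LefschetzModelFacts.lean`,
`Literature/Geometry/Symplectic/LefschetzSteinRealisation.lean`), taken as hypotheses:

1. `modelsOnFibred_exists` (Etnyre–Fuller 2006 Thm. 1 / Prop. 12, Baykur 2006 Lemma 1): a fibred model
   `ModelsOnFibred M g l` with non-zero classes — `M` is compact, connected and orientable by the PROVED
   homotopy-sphere facts of the tree;
2. `modelsOn_counts_of_homotopyEquiv_sphere` (Gompf–Stipsicz §8.2): `4g` letters, classes span, product `1`;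
3. `modelsOnFibred_balance_of_homotopyEquiv_sphere` (Etnyre–Fuller eq. (d3)): `2g` positive letters;
4. `modelsOnFibred_of_reach` (Baykur §5, Etnyre–Fuller §2): the reachable sorted word `l' = P ++ N` is again
   a fibred model of `M`; its classes are non-zero and it has `2g'` positive letters by the PROVED
   bookkeeping `Reach.forall_ne_zero`, `Reach.length_filter_eq_two_mul` (`SignedHurwitzReach.lean`);
5. `steinRealisation_of_sorted_modelsOnFibred` (Baykur Thm. 5.1 proof, Akbulut–Ozbagci Thm. 5, Eliashberg,
   Gay, Giroux): `M = W₁ ∪_φ W₂`, Stein structures, one open book, `W₁ = X(F; P)`;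
6. `isLefschetzHandlebody_homology` (Gompf–Stipsicz §8.2): `W₁` connected, `H₁(W₁; ℤ) ≅ ℤ^{2g'}/⟨letters P⟩`,
   ℚ-acyclic since the `2g'` positive classes span.

Pure bookkeeping otherwise (`classesOfSign (P ++ N) true = letters P`, `(P ++ N).filter (·.2) = P`).
The result is CONDITIONAL on the six facts (hypotheses `h₁ … h₆`); it supports the item, it does not
close it.
-/

noncomputable section

-- the prescribed namespace `Summit.<P>.<Sub>.…` duplicates `SmoothPoincare4` (P = Sub)
set_option linter.dupNamespace false

open scoped Manifold ContDiff Topology ContinuousMap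
open Set Function
open Literature.GroupTheory.CombinatorialGroupTheory.SignedHurwitz
open Literature.Topology.FourManifolds Literature.Topology.FourManifolds.LefschetzBase
open Literature.Geometry.Symplectic (SteinStructure boundaryPlaneField OpenBook wedge₁₂
  steinRealisation_of_sorted_modelsOnFibred)
open Literature.AlgebraicTopology.SingularHomology (singularHomology)

namespace Summit.SmoothPoincare4.SmoothPoincare4.Theorems.AcyclicBisectionExists.ModpBraidOrbits

/-! ## Bookkeeping of sorted words -/

section SortedWords

variable {V : Type*}

/-- In a word all of whose letters are positive, the positive classes are all the classes. [folklore] -/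
theorem classesOfSign_true_eq_letters_of_forall {P : List (V × Bool)} (hP : ∀ x ∈ P, x.2 = true) :
    classesOfSign P true = letters P := by
  ext v
  simp only [classesOfSign, letters, Set.mem_setOf_eq]
  constructor
  · intro h; exact ⟨true, h⟩
  · rintro ⟨s, hs⟩
    have := hP _ hs
    simp only at this
    subst this
    exact hs

/-- In a word all of whose letters are negative there are no positive classes. [folklore] -/
theorem classesOfSign_true_eq_empty_of_forall {N : List (V × Bool)} (hN : ∀ x ∈ N, x.2 = false) :
    classesOfSign N true = ∅ := by
  ext v
  simp only [classesOfSign, Set.mem_setOf_eq, Set.mem_empty_iff_false, iff_false]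
  intro h
  have := hN _ h
  simp at this

/-- The positive classes of a sorted word `P ++ N` are the classes of `P`. [folklore] -/
theorem classesOfSign_true_sorted {P N : List (V × Bool)} (hP : ∀ x ∈ P, x.2 = true)
    (hN : ∀ x ∈ N, x.2 = false) : classesOfSign (P ++ N) true = letters P := by
  rw [classesOfSign_append, classesOfSign_true_eq_letters_of_forall hP,
    classesOfSign_true_eq_empty_of_forall hN, Set.union_empty]

/-- The positive letters of a sorted word `P ++ N` are `P`. [folklore] -/
theorem filter_snd_sorted {P N : List (V × Bool)} (hP : ∀ x ∈ P, x.2 = true)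
    (hN : ∀ x ∈ N, x.2 = false) : (P ++ N).filter (·.2) = P := by
  rw [List.filter_append, List.filter_eq_self.2 (by simpa using hP),
    List.filter_eq_nil_iff.2 (by simpa using hN), List.append_nil]

/-- Signs are unchanged by a change of coefficients. [folklore] -/
theorem forall_snd_mapWord {W : Type*} (φ : V → W) {L : List (V × Bool)} {b : Bool}
    (hL : ∀ x ∈ L, x.2 = b) : ∀ x ∈ mapWord φ L, x.2 = b := by
  intro x hx
  obtain ⟨y, hy, rfl⟩ := List.mem_map.1 hx
  exact hL y hy

end SortedWords

/-! ## The dictionary stub from the six named facts -/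

/-- **The sorted-model dictionary of a nice splitting of a homotopy 4-sphere, from the six named facts
of the Lefschetz-handlebody dictionary** (Etnyre–Fuller 2006 Thm. 1/Prop. 12/eq. (d3); Baykur 2006
Lemma 1, §5, Thm. 5.1; Gompf–Stipsicz 1999 §8.2; Akbulut–Ozbagci 2001 Thm. 5).  The conclusion is
verbatim the registered signature of `stub_sortedModelOfHandleSplitting` (line `modp-braid-orbits`, r8);
the nice-splitting hypotheses are not used (the fibred model of fact 1 is taken on `M` directly, which is
compact, connected and orientable by the proved homotopy-sphere facts of the tree).
[cite: EtnyreFuller2006, Thm. 1, Prop. 12, eq. (d3)] [cite: Baykur2006, Lemma 1 and Thm. 5.1]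
[cite: GompfStipsicz1999, §8.2] -/
theorem stub_sortedModelOfHandleSplitting_of :
    modelsOnFibred_exists → modelsOn_counts_of_homotopyEquiv_sphere →
    modelsOnFibred_balance_of_homotopyEquiv_sphere → modelsOnFibred_of_reach →
    isLefschetzHandlebody_homology → steinRealisation_of_sorted_modelsOnFibred →
    ∀ (M : Type) [TopologicalSpace M] [T2Space M] [SecondCountableTopology M]
      [ChartedSpace (EuclideanSpace ℝ (Fin 4)) M] [IsManifold (𝓡 4) ∞ M],
      M ≃ₕ Metric.sphere (0 : EuclideanSpace ℝ (Fin 5)) 1 →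
      ∀ (A : Type) [TopologicalSpace A] [T2Space A] [SecondCountableTopology A] [CompactSpace A]
        [ChartedSpace (EuclideanHalfSpace 4) A] [IsManifold (𝓡∂ 4) ∞ A]
        (B : Type) [TopologicalSpace B] [T2Space B] [SecondCountableTopology B] [CompactSpace B]
        [ChartedSpace (EuclideanHalfSpace 4) B] [IsManifold (𝓡∂ 4) ∞ B]
        (bA : BoundaryData (𝓡∂ 4) A (𝓡 3)) (bB : BoundaryData (𝓡∂ 4) B (𝓡 3))
        (φ₀ : bA.carrier ≃ₘ⟮𝓡 3, 𝓡 3⟯ bB.carrier),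
        IsHandlebodyOfIndexLE 3 2 A → IsHandlebodyOfIndexLE 3 1 B → IsBoundaryGluing bA bB φ₀ (𝓡 4) M →
        Nonempty bA.carrier → ConnectedSpace A → ConnectedSpace B → ConnectedSpace bA.carrier →
        CategoryTheory.Limits.IsZero (singularHomology ℚ ℚ A 1) →
      ∃ (g : ℕ) (l : IntWord g),
        l.length = 4 * g ∧ (l.filter (·.2)).length = 2 * g ∧
        (∀ x ∈ l, x.1 ≠ 0) ∧
        Submodule.span ℚ (letters (ratWord l)) = ⊤ ∧
        wordProduct (stdSymp ℤ g) l = 1 ∧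
        ∀ (g' : ℕ) (l' : IntWord g'),
          Reach g l g' l' → Sorted l' →
          Submodule.span ℚ (classesOfSign (ratWord l') true) = ⊤ →
          Submodule.span ℚ (classesOfSign (ratWord l') false) = ⊤ →
          ∃ (W₁ : Type) (_ : TopologicalSpace W₁) (_ : ChartedSpace (EuclideanHalfSpace 4) W₁)
            (_ : IsManifold (𝓡∂ 4) ∞ W₁) (_ : CompactSpace W₁)
            (W₂ : Type) (_ : TopologicalSpace W₂) (_ : ChartedSpace (EuclideanHalfSpace 4) W₂)
            (_ : IsManifold (𝓡∂ 4) ∞ W₂) (_ : CompactSpace W₂)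
            (S₁ : SteinStructure W₁) (S₂ : SteinStructure W₂)
            (b₁ : BoundaryData (𝓡∂ 4) W₁ (𝓡 3)) (b₂ : BoundaryData (𝓡∂ 4) W₂ (𝓡 3))
            (φ : b₁.carrier ≃ₘ⟮𝓡 3, 𝓡 3⟯ b₂.carrier)
            (ob : OpenBook b₁.carrier)
            (α₁ α₂ : Literature.Geometry.Kaehler.MForm (𝓡 3) b₁.carrier ℝ 1),
            IsBoundaryGluing b₁ b₂ φ (𝓡 4) M ∧
            ob.IsGirouxForm (boundaryPlaneField S₁.J b₁) α₁ ∧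
            ob.IsGirouxForm (fun y => (boundaryPlaneField S₂.J b₂ (φ y)).comap
              (mfderiv (𝓡 3) (𝓡 3) φ y).toLinearMap) α₂ ∧
            (∀ y u v w, 0 < wedge₁₂ (α₁ y) (Literature.Geometry.Kaehler.mextDeriv α₁ y) u v w ↔
              0 < wedge₁₂ (α₂ y) (Literature.Geometry.Kaehler.mextDeriv α₂ y) u v w) ∧
            ConnectedSpace W₁ ∧
            (∀ k, 0 < k → CategoryTheory.Limits.IsZero (singularHomology ℚ ℚ W₁ k)) ∧
            Nonempty ((singularHomology ℤ ℤ W₁ 1) ≃ₗ[ℤ]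
              ((Fin g' ⊕ Fin g' → ℤ) ⧸ Submodule.span ℤ (classesOfSign l' true))) := by
  intro h₁ h₂ h₃ h₄ h₅ h₆ M _ _ _ _ _ e A _ _ _ _ _ _ B _ _ _ _ _ _ bA bB φ₀ _ _ _ _ _ _ _ _
  -- `M` is compact, connected, orientable (proved homotopy-sphere facts of the tree)
  haveI : CompactSpace M := compactSpace_of_homotopyEquiv_sphere_four_holds M e
  haveI : SimplyConnectedSpace (Metric.sphere (0 : EuclideanSpace ℝ (Fin 5)) 1) :=
    simplyConnectedSpace_sphere_four_holds
  haveI : SimplyConnectedSpace M := e.simplyConnectedSpace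
  haveI : ConnectedSpace M := inferInstance
  have hor : IsOrientable (𝓡 4) M := isOrientable_of_homotopyEquiv_sphere_four_holds M e
  -- fact 1: an allowable fibred model
  obtain ⟨g, l, hnz, hfib⟩ := h₁ M hor
  -- facts 2, 3: the counts of a homotopy 4-sphere
  obtain ⟨hlen, hspan, hprod⟩ := h₂ M g l e hfib.modelsOn
  have hbal : (l.filter (·.2)).length = 2 * g := h₃ M g l e hfib
  refine ⟨g, l, hlen, hbal, hnz, hspan, hprod, ?_⟩
  -- the realisation clause
  intro g' l' hreach hsorted hpos _hneg
  -- fact 4: the reachable word is again a fibred model; proved bookkeeping along `Reach`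
  have hfib' : ModelsOnFibred M g' l' := h₄ M g l g' l' hfib hreach
  have hnz' : ∀ x ∈ l', x.1 ≠ 0 := hreach.forall_ne_zero hnz
  have hbal' : (l'.filter (·.2)).length = 2 * g' := hreach.length_filter_eq_two_mul hbal
  obtain ⟨P, N, rfl, hP, hN⟩ := hsorted
  -- fact 6: Baykur's Stein realisation of the sorted fibred model
  obtain ⟨W₁, _, _, _, _, _, _, W₂, _, _, _, _, S₁, S₂, b₁, b₂, φ, ob, α₁, α₂, hglue, hG₁, hG₂,
    hor', hLH⟩ := h₆ M g' P N hfib' hP hN hnz'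
  -- fact 5: homology of the Lefschetz handlebody `W₁ = X(F; P)`
  obtain ⟨hconn, ⟨iso⟩, hacyc⟩ := h₅ g' P W₁ hLH
  -- bookkeeping: positive classes of `P ++ N` are the classes of `P`; `P` has `2g'` letters
  have hcl : classesOfSign (P ++ N) true = letters P := classesOfSign_true_sorted hP hN
  have hclQ : classesOfSign (ratWord (P ++ N)) true = letters (ratWord P) := by
    rw [ratWord, mapWord_append]
    exact classesOfSign_true_sorted (forall_snd_mapWord _ hP) (forall_snd_mapWord _ hN)
  have hlenP : P.length = 2 * g' := by rw [← hbal', filter_snd_sorted hP hN]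
  have hspanP : Submodule.span ℚ (letters (ratWord P)) = ⊤ := by rw [← hclQ]; exact hpos
  refine ⟨W₁, inferInstance, inferInstance, inferInstance, inferInstance, W₂, inferInstance,
    inferInstance, inferInstance, inferInstance, S₁, S₂, b₁, b₂, φ, ob, α₁, α₂, hglue, hG₁, hG₂, hor',
    hconn, hacyc hspanP hlenP, ?_⟩
  rw [hcl]
  exact ⟨iso⟩

end Summit.SmoothPoincare4.SmoothPoincare4.Theorems.AcyclicBisectionExists.ModpBraidOrbits

end
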